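import Mathlib
import Summits.MatrixMultiplication.MatrixMultiplication.Theses.FidelityWitnesses
import Summits.MatrixMultiplication.MatrixMultiplication.Theorems.FidelityWitnessesFidelityGapTwoSixConeClosure
import Summits.MatrixMultiplication.MatrixMultiplication.Theorems.FidelityWitnessesFidelityGapTwoSixRankConeSmul

/-!
# `FidelityWitnesses.WitnessCompleteness` (stmt-MatrixMultiplication-4962) — proved

The bipolar / witness theorem for the rank locus in the classical topology: for a non-zero
`3`-tensor `T : ι → κ → μ → ℂ` of finite format and `r : ℕ`,

  `T ∉ closure {S | R(S) ≤ r}  ↔  ∃ ε > 0, ∀ S, R(S) ≤ r → |⟨S,T⟩|² ≤ (1 − ε)·‖S‖²·‖T‖²`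

(sesquilinear overlap `⟨S,T⟩ = Σ conj(S_abc)·T_abc`, coordinate `ℓ²` sums).

* (⇒) is the contrapositive of the closure criterion for a complex cone, already in the tree as
  `stub_coneClosure` (file `FidelityWitnessesFidelityGapTwoSixConeClosure`: if the overlaps of `T`
  with the cone come arbitrarily close to `‖S‖²‖T‖²`, project `T` onto the complex line through a
  near-optimal `S` — the line stays in the cone — and `T` is a limit), applied to the cone
  `{S | R(S) ≤ r}` (`stub_rankConeSmul`: `R(c • S) ≤ R(S)`).
* (⇐) is continuity: the gap inequality defines a closed set containing the rank locus, hence its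
  closure; at `S = T` it reads `‖T‖⁴ ≤ (1 − ε)‖T‖⁴`, impossible for `T ≠ 0`.

With Alder's theorem (`alder_secantVariety_eq_setOf_algBorderRank_le_holds`, Zariski = Euclidean
closure of the rank locus over `ℂ`) the closure is `{algBorderRank ≤ r}`, so fidelity witnesses are
complete for border rank; that reading is not needed here and is not imported.
-/

namespace Summit.MatrixMultiplication.MatrixMultiplication.Theorems

open scoped BigOperators ComplexConjugate
open Literature.Computability.AlgebraicComplexity

/-- The sesquilinear self-overlap of a tensor is its squared `ℓ²` norm:
`Σ conj(T_abc)·T_abc = Σ ‖T_abc‖²` (as a complex number). [folklore] -/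
theorem witnessCompleteness_self_overlap {ι κ μ : Type} [Fintype ι] [Fintype κ] [Fintype μ]
    (T : ι → κ → μ → ℂ) :
    (∑ a, ∑ b, ∑ c, (starRingEnd ℂ) (T a b c) * T a b c) =
      ((∑ a, ∑ b, ∑ c, ‖T a b c‖ ^ 2 : ℝ) : ℂ) := by
  push_cast
  refine Finset.sum_congr rfl fun a _ => Finset.sum_congr rfl fun b _ =>
    Finset.sum_congr rfl fun c _ => ?_
  rw [Complex.conj_mul']

/-- A tensor with vanishing squared `ℓ²` norm is zero. [folklore] -/
theorem witnessCompleteness_eq_zero_of_sum_eq_zero {ι κ μ : Type} [Fintype ι] [Fintype κ]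
    [Fintype μ] (T : ι → κ → μ → ℂ) (h : (∑ a, ∑ b, ∑ c, ‖T a b c‖ ^ 2) = 0) : T = 0 := by
  funext a b c
  have ha := (Finset.sum_eq_zero_iff_of_nonneg (fun a _ => Finset.sum_nonneg fun b _ =>
    Finset.sum_nonneg fun c _ => by positivity)).1 h a (Finset.mem_univ _)
  have hb := (Finset.sum_eq_zero_iff_of_nonneg (fun b _ =>
    Finset.sum_nonneg fun c _ => by positivity)).1 ha b (Finset.mem_univ _)
  have hc := (Finset.sum_eq_zero_iff_of_nonneg (fun c _ => by positivity)).1 hb c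
    (Finset.mem_univ _)
  simpa using hc

/-- **Soundness of fidelity witnesses (direction ⇐ of `WitnessCompleteness`).**  If a fidelity gap
`ε > 0` holds on a set `C` of tensors, then no non-zero `T` is a limit of elements of `C`: the gap
inequality is a closed condition in `S`, so it persists on `closure C`, and at `S = T` it reads
`‖T‖⁴ ≤ (1 − ε)·‖T‖⁴`. [folklore] -/
theorem witnessCompleteness_notMem_closure_of_gap {ι κ μ : Type} [Fintype ι] [Fintype κ]
    [Fintype μ] (C : Set (ι → κ → μ → ℂ)) (T : ι → κ → μ → ℂ) (hT : T ≠ 0) (ε : ℝ) (hε : 0 < ε)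
    (hgap : ∀ S ∈ C, ‖∑ a, ∑ b, ∑ c, (starRingEnd ℂ) (S a b c) * T a b c‖ ^ 2 ≤
      (1 - ε) * (∑ a, ∑ b, ∑ c, ‖S a b c‖ ^ 2) * (∑ a, ∑ b, ∑ c, ‖T a b c‖ ^ 2)) :
    T ∉ closure C := by
  intro hmem
  -- the gap set is closed and contains `C`, hence `closure C`
  have hcontS : ∀ (a : ι) (b : κ) (c : μ), Continuous fun S : ι → κ → μ → ℂ => S a b c :=
    fun a b c => (continuous_apply c).comp ((continuous_apply b).comp (continuous_apply a))
  have hcont1 : Continuous fun S : ι → κ → μ → ℂ =>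
      ‖∑ a, ∑ b, ∑ c, (starRingEnd ℂ) (S a b c) * T a b c‖ ^ 2 := by
    refine (continuous_finsetSum _ fun a _ => continuous_finsetSum _ fun b _ =>
      continuous_finsetSum _ fun c _ => ?_).norm.pow 2
    exact (Complex.continuous_conj.comp (hcontS a b c)).mul continuous_const
  have hcont2 : Continuous fun S : ι → κ → μ → ℂ =>
      (1 - ε) * (∑ a, ∑ b, ∑ c, ‖S a b c‖ ^ 2) * (∑ a, ∑ b, ∑ c, ‖T a b c‖ ^ 2) := by
    refine (continuous_const.mul (continuous_finsetSum _ fun a _ => continuous_finsetSum _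
      fun b _ => continuous_finsetSum _ fun c _ => ?_)).mul continuous_const
    exact (hcontS a b c).norm.pow 2
  have hclosed : IsClosed {S : ι → κ → μ → ℂ |
      ‖∑ a, ∑ b, ∑ c, (starRingEnd ℂ) (S a b c) * T a b c‖ ^ 2 ≤
        (1 - ε) * (∑ a, ∑ b, ∑ c, ‖S a b c‖ ^ 2) * (∑ a, ∑ b, ∑ c, ‖T a b c‖ ^ 2)} :=
    isClosed_le hcont1 hcont2
  have hsub : C ⊆ {S : ι → κ → μ → ℂ |
      ‖∑ a, ∑ b, ∑ c, (starRingEnd ℂ) (S a b c) * T a b c‖ ^ 2 ≤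
        (1 - ε) * (∑ a, ∑ b, ∑ c, ‖S a b c‖ ^ 2) * (∑ a, ∑ b, ∑ c, ‖T a b c‖ ^ 2)} :=
    fun S hS => hgap S hS
  have hTgap : ‖∑ a, ∑ b, ∑ c, (starRingEnd ℂ) (T a b c) * T a b c‖ ^ 2 ≤
      (1 - ε) * (∑ a, ∑ b, ∑ c, ‖T a b c‖ ^ 2) * (∑ a, ∑ b, ∑ c, ‖T a b c‖ ^ 2) :=
    closure_minimal hsub hclosed hmem
  -- at `S = T` the overlap is `‖T‖²`
  obtain ⟨t2, ht2⟩ : ∃ t2 : ℝ, (∑ a, ∑ b, ∑ c, ‖T a b c‖ ^ 2) = t2 := ⟨_, rfl⟩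
  rw [witnessCompleteness_self_overlap, ht2, Complex.norm_real, Real.norm_eq_abs] at hTgap
  have ht2_nonneg : 0 ≤ t2 := ht2 ▸ Finset.sum_nonneg fun a _ =>
    Finset.sum_nonneg fun b _ => Finset.sum_nonneg fun c _ => by positivity
  rw [abs_of_nonneg ht2_nonneg] at hTgap
  -- so `ε · t2² ≤ 0`, forcing `t2 = 0` and `T = 0`
  have ht2sq : t2 ^ 2 = 0 := by nlinarith [sq_nonneg t2]
  have ht20 : t2 = 0 := pow_eq_zero_iff (n := 2) (by norm_num) |>.1 ht2sq
  exact hT (witnessCompleteness_eq_zero_of_sum_eq_zero T (ht2.trans ht20))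

/-- **`WitnessCompleteness` (item `stmt-MatrixMultiplication-4962` of route
`MatrixMultiplication/FidelityWitnesses`) — the bipolar / witness theorem for the rank locus in the
classical topology.**  For a non-zero tensor `T` of finite format and `r : ℕ`, `T` is not a limit of
rank-`≤ r` tensors iff some `ε > 0` bounds the fidelity of every rank-`≤ r` tensor with `T` away
from `1`: `|⟨S,T⟩|² ≤ (1 − ε)·‖S‖²·‖T‖²`.  (⇒): otherwise near-optimal overlaps inside the complex
cone `{R ≤ r}` (`stub_rankConeSmul`) put `T` in its closure (`stub_coneClosure`).  (⇐): the gap is a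
closed condition, so it holds on the closure, and fails at `S = T ≠ 0`
(`witnessCompleteness_notMem_closure_of_gap`). [folklore] -/
theorem witnessCompleteness_proof :
    Summit.MatrixMultiplication.MatrixMultiplication.Theses.FidelityWitnesses.WitnessCompleteness := by
  unfold Summit.MatrixMultiplication.MatrixMultiplication.Theses.FidelityWitnesses.WitnessCompleteness
  intro ι κ μ _ _ _ T r hT
  constructor
  · intro hnot
    by_contra hgap
    refine hnot (stub_coneClosure _ (fun c S hS => ?_) _ fun ε hε => ?_)
    · show tensorRank (c • S) ≤ r
      exact (stub_rankConeSmul c S).trans hS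
    · push Not at hgap
      obtain ⟨S, hS, hlt⟩ := hgap ε hε
      exact ⟨S, hS, hlt⟩
  · rintro ⟨ε, hε, hgap⟩
    exact witnessCompleteness_notMem_closure_of_gap _ T hT ε hε fun S hS => hgap S hS

end Summit.MatrixMultiplication.MatrixMultiplication.Theorems
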